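import Mathlib

/-!
# L2′ PROVED (r12) — the shared divisor-first face game along Γ = D_u ∩ D_v terminates, for every order of play

[OURS · L1 W4.2 · crux stmt-ResolutionOfSingularities-18506 / conjunct 19249 · IDEATOR 2 (res-L1-w42-idea-2) gen 11, r12 · counted 0 ·
row of record `SharedPlayFiniteDivisorFirstNE` (r11, tri-1 TRIAGE v6.5 §R13-I2 repair of the r10 row); r11 file `sigma-r11/SharedGame2-r11.lean`]

THEOREM (this file, no `sorry`): `sharedPlayFiniteDivisorFirstNE_holds : SharedPlayFiniteDivisorFirstNE`, obtained from the stronger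
`no_infinite_dfPlay`: for EVERY nonempty finite `B ⊂ ℤ²` (no sign condition), every marking `m ≥ 1` and EVERY starting fan, there is no
infinite sequence of divisor-first legal moves — in particular termination does not depend on the ORDER in which the sites sharing Γ impose
their moves (bears on CRUX-PLAN (GN′)/r-66 in the dim-2 shadow).  Sharpness: `not_sharedPlayFiniteDivisorFirst` (B = ∅, tri-1) and
`freePlay_infinite` (B = {(1,0)}, m = 1: WITHOUT the divisor-first discipline the pair move can be played for ever) — both binders of the row are needed.

PROOF IDEA (new in r12; replaces the sector/Stern–Brocot sketch of r11).  Two potentials on the fan `L = (r₀, …, r_k)`, rays `rᵢ = (vᵢ, bᵢ)`: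
* the CROSSING WEIGHT of a cone `(v, v′)`:  `D(v,v′) := Σ_{(a,a′) ∈ B×B, ⟨a−a′,v⟩ > 0 > ⟨a−a′,v′⟩} (⟨a−a′,v⟩ − ⟨a−a′,v′⟩) ≥ 0` — the total amount by
  which the two rays DISAGREE on the order of the cloud.  Under ANY subdivision `(v,v′) ↦ (v,v+v′), (v+v′,v′)` it splits sub-additively and
  STRICTLY when positive (`D_split_lt`: a separated pair `x > 0 > y` survives in at most one child, with weight `−y < x−y` or `x < x−y`), and
  `D = 0` forces a COMMON MINIMISER `a* ∈ B` of `⟨·,v⟩` and `⟨·,v′⟩` (`exists_common_min`), whence `h(v+v′) = h(v) + h(v′)` for the support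
  function `h(v) := min_{a∈B} ⟨a,v⟩`;
* the RESIDUE `μ(r) := h(v) − m·b` of a ray.  On a `D = 0` cone a divisor-first pair move has `μ(r), μ(r′) < m ≤ μ(r) + μ(r′)` (the two
  singletons are illegal, the pair is legal at `a*`), so the new ray has `μ″ = μ + μ′ − m` with `0 ≤ μ″ < min(μ, μ′)`.
The cone potential `F(r,r′) := 3^e`, `e := m+1+D(v,v′)` if `D > 0`, else `e := min(μ(r), μ(r′), m)`, summed over adjacent cones (`P1`), drops
STRICTLY at every pair move (`3^{e₁} + 3^{e₂} < 3^{e}` when `e₁, e₂ < e`) and weakly at every singleton move; `P2 := Σ μ` drops strictly (by `m`)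
at every singleton move.  An infinite play would make `P1` eventually constant, after which only singleton moves occur and `P2` decreases for ever.
NOT a statement of the manuscript under review; AI ideation, weaker than expert review.
-/

set_option linter.dupNamespace false -- mandated `Summit.ResolutionOfSingularities.ResolutionOfSingularities` prefix of this single-conjunct summit


/-! HOIST NOTE (filing seat res-D-pv-002 g4; AUTHORSHIP res-L1-w42-idea-2 g11, `sigma-r12/SharedGame2-r12.lean` sha16 04badbd0b10fd4bb, farm rc 0,
idea-2 RESULT r12 2026-08-27T15:08:08Z «hoist at will»; `--supports stmt-ResolutionOfSingularities-19249 --as helper`, counted 0).  The 464-line file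
exceeds the 400-line module cap and is filed as TWO modules: this one = §0–§2 (game, rows, pairing/support function/residue, crossing weight) and
`…Corridor3SigmaSharedGame2` = §3–§5 (potential, termination `no_infinite_dfPlay`, `sharedPlayFiniteDivisorFirstNE_holds`, sharpness).  Text
byte-for-byte except gate-forced deltas: one-line docstrings on the plumbing lemmas the sketch left undocumented, `set_option linter.unusedVariables
false` dropped. -/

namespace Summit.ResolutionOfSingularities.ResolutionOfSingularities.Cruxes.SigmaMaxModifications.IdeasL1Idea2R12.SharedGame2


/-! ## §0 The game (verbatim from r10/r11) -/

/-- A ray of a 2-dimensional height fan: primitive vector and height.  [OURS] -/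
structure Ray2 where
  v : ℤ × ℤ
  b : ℤ

/-- Scaled coordinate of the exponent `a` on the ray `r` for the marking `m`: `⟨a, v⟩ − m·b`.  [OURS] -/
def sc (m : ℤ) (a : ℤ × ℤ) (r : Ray2) : ℤ := a.1 * r.v.1 + a.2 * r.v.2 - m * r.b

/-- The singleton (divisor) move on the ray `r` is legal: every scaled coordinate is `≥ m`.  [OURS] -/
abbrev SingletonLegal (B : Finset (ℤ × ℤ)) (m : ℤ) (r : Ray2) : Prop := ∀ a ∈ B, m ≤ sc m a r

/-- The pair (curve) move on the cone `(r, r')` is legal: every corner sum is `≥ m`.  [OURS] -/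
abbrev PairLegal (B : Finset (ℤ × ℤ)) (m : ℤ) (r r' : Ray2) : Prop := ∀ a ∈ B, m ≤ sc m a r + sc m a r'

/-- One DIVISOR-FIRST legal move of the shared game (r10).  [OURS] -/
inductive DFStep (B : Finset (ℤ × ℤ)) (m : ℤ) : List Ray2 → List Ray2 → Prop
  | single (L₁ L₂ : List Ray2) (r : Ray2) :
      SingletonLegal B m r → DFStep B m (L₁ ++ r :: L₂) (L₁ ++ ⟨r.v, r.b + 1⟩ :: L₂)
  | pair (L₁ L₂ : List Ray2) (r r' : Ray2) :
      PairLegal B m r r' → ¬ SingletonLegal B m r → ¬ SingletonLegal B m r' →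
      DFStep B m (L₁ ++ r :: r' :: L₂) (L₁ ++ r :: ⟨r.v + r'.v, r.b + r'.b + 1⟩ :: r' :: L₂)

/-- A legal move with NO discipline (r10).  [OURS] -/
inductive FreeStep (B : Finset (ℤ × ℤ)) (m : ℤ) : List Ray2 → List Ray2 → Prop
  | single (L₁ L₂ : List Ray2) (r : Ray2) :
      SingletonLegal B m r → FreeStep B m (L₁ ++ r :: L₂) (L₁ ++ ⟨r.v, r.b + 1⟩ :: L₂)
  | pair (L₁ L₂ : List Ray2) (r r' : Ray2) :
      PairLegal B m r r' → FreeStep B m (L₁ ++ r :: r' :: L₂) (L₁ ++ r :: ⟨r.v + r'.v, r.b + r'.b + 1⟩ :: r' :: L₂)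

/-- A divisor-first move is a free move.  [OURS · proved] -/
theorem freeStep_of_dfStep {B : Finset (ℤ × ℤ)} {m : ℤ} {L L' : List Ray2} (h : DFStep B m L L') : FreeStep B m L L' := by
  cases h with
  | single L₁ L₂ r hr => exact FreeStep.single L₁ L₂ r hr
  | pair L₁ L₂ r r' hp _ _ => exact FreeStep.pair L₁ L₂ r r' hp

/-- The initial shared fan of Γ = D_u ∩ D_v: the single cone `(e_u, e_v)`, heights 0.  [OURS] -/
def initFan2 : List Ray2 := [⟨(1, 0), 0⟩, ⟨(0, 1), 0⟩]

/-- The r10 row, AS TYPED (kept only to record its refutation).  [OURS · REFUTED as typed, tri-1 R13-I2] -/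
def SharedPlayFiniteDivisorFirst : Prop :=
  ∀ (B : Finset (ℤ × ℤ)) (m : ℤ), 1 ≤ m → (∀ a ∈ B, 0 ≤ a.1 ∧ 0 ≤ a.2) →
    ¬ ∃ f : ℕ → List Ray2, f 0 = initFan2 ∧ ∀ n, DFStep B m (f n) (f (n + 1))

/-- tri-1's refutation reproduced: for `B = ∅` the singleton move on `e_u` is vacuously legal for ever.  [tri-1 `Tri1R13L2`, re-proved · PROVED] -/
theorem not_sharedPlayFiniteDivisorFirst : ¬ SharedPlayFiniteDivisorFirst := by
  intro h
  refine h ∅ 1 le_rfl (by simp) ⟨fun n => [⟨(1, 0), (n : ℤ)⟩, ⟨(0, 1), 0⟩], rfl, fun n => ?_⟩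
  have step := DFStep.single (B := ∅) (m := 1) [] [⟨(0, 1), 0⟩] ⟨(1, 0), (n : ℤ)⟩ (by simp [SingletonLegal])
  simpa using step

/-- [OURS · L1 W4.2 · ROW OF RECORD from r11 · **PROVED in r12** (`sharedPlayFiniteDivisorFirstNE_holds`)] For every NONEMPTY cloud `B ⊂ ℕ²` and
marking `m ≥ 1` there is no infinite divisor-first legal play of the shared game from the initial fan.  NOT a statement of the manuscript. -/
def SharedPlayFiniteDivisorFirstNE : Prop :=
  ∀ (B : Finset (ℤ × ℤ)) (m : ℤ), 1 ≤ m → B.Nonempty → (∀ a ∈ B, 0 ≤ a.1 ∧ 0 ≤ a.2) →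
    ¬ ∃ f : ℕ → List Ray2, f 0 = initFan2 ∧ ∀ n, DFStep B m (f n) (f (n + 1))

/-! ## §1 Pairing, support function, residue -/

/-- `⟨a, v⟩`.  [OURS] -/
def ip (a v : ℤ × ℤ) : ℤ := a.1 * v.1 + a.2 * v.2

/-- The pairing is additive in the vector.  [OURS · plumbing] -/
theorem ip_add (a v v' : ℤ × ℤ) : ip a (v + v') = ip a v + ip a v' := by
  simp only [ip, Prod.fst_add, Prod.snd_add]; ring

/-- The scaled coordinate through the pairing.  [OURS · plumbing] -/
theorem sc_eq (m : ℤ) (a : ℤ × ℤ) (r : Ray2) : sc m a r = ip a r.v - m * r.b := rfl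

/-- Support function `h_B(v) := min_{a ∈ B} ⟨a, v⟩` (junk value `0` for `B = ∅`).  [OURS] -/
def hgt (B : Finset (ℤ × ℤ)) (v : ℤ × ℤ) : ℤ := if h : B.Nonempty then B.inf' h (fun a => ip a v) else 0

/-- The support function is below every pairing value.  [OURS · plumbing] -/
theorem hgt_le {B : Finset (ℤ × ℤ)} {a : ℤ × ℤ} (ha : a ∈ B) (v : ℤ × ℤ) : hgt B v ≤ ip a v := by
  unfold hgt; rw [dif_pos ⟨a, ha⟩]; exact Finset.inf'_le _ ha

/-- A common lower bound of the pairing values bounds the support function from below.  [OURS · plumbing] -/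
theorem le_hgt {B : Finset (ℤ × ℤ)} (hB : B.Nonempty) {v : ℤ × ℤ} {c : ℤ} (h : ∀ a ∈ B, c ≤ ip a v) : c ≤ hgt B v := by
  unfold hgt; rw [dif_pos hB]; exact Finset.le_inf' _ _ h

/-- The support function is attained at a minimiser.  [OURS · plumbing] -/
theorem hgt_eq_of_min {B : Finset (ℤ × ℤ)} {a : ℤ × ℤ} (ha : a ∈ B) {v : ℤ × ℤ} (hmin : ∀ c ∈ B, ip a v ≤ ip c v) :
    hgt B v = ip a v :=
  le_antisymm (hgt_le ha v) (le_hgt ⟨a, ha⟩ hmin)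

/-- Super-additivity of the support function.  [OURS · proved] -/
theorem hgt_add_ge {B : Finset (ℤ × ℤ)} (hB : B.Nonempty) (v v' : ℤ × ℤ) : hgt B v + hgt B v' ≤ hgt B (v + v') :=
  le_hgt hB fun a ha => by rw [ip_add]; exact add_le_add (hgt_le ha v) (hgt_le ha v')

/-- Residue of a ray: `μ(r) := h_B(v) − m·b`.  [OURS] -/
def mu (B : Finset (ℤ × ℤ)) (m : ℤ) (r : Ray2) : ℤ := hgt B r.v - m * r.b

/-- Residue truncated to `ℕ`.  [OURS] -/
def muN (B : Finset (ℤ × ℤ)) (m : ℤ) (r : Ray2) : ℕ := (mu B m r).toNat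

/-- A singleton move lowers the residue by `m`.  [OURS · plumbing] -/
theorem mu_single (B : Finset (ℤ × ℤ)) (m : ℤ) (r : Ray2) : mu B m ⟨r.v, r.b + 1⟩ = mu B m r - m := by
  simp only [mu]; ring

/-- A legal singleton has residue `≥ m`.  [OURS · proved] -/
theorem m_le_mu_of_singletonLegal {B : Finset (ℤ × ℤ)} (hB : B.Nonempty) {m : ℤ} {r : Ray2} (h : SingletonLegal B m r) :
    m ≤ mu B m r := by
  have : m + m * r.b ≤ hgt B r.v := le_hgt hB fun a ha => by have := h a ha; rw [sc_eq] at this; linarith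
  unfold mu; linarith

/-- An illegal singleton has residue `< m`.  [OURS · proved] -/
theorem mu_lt_of_not_singletonLegal {B : Finset (ℤ × ℤ)} {m : ℤ} {r : Ray2} (h : ¬ SingletonLegal B m r) : mu B m r < m := by
  obtain ⟨c, hc, hlt⟩ : ∃ c ∈ B, sc m c r < m := by simpa [SingletonLegal, not_forall, not_le] using h
  have := hgt_le hc r.v
  rw [sc_eq] at hlt; unfold mu; linarith

/-! ## §2 The crossing weight -/

/-- Crossing weight of one ordered pair in difference coordinates `x = ⟨a−a′,v⟩`, `y = ⟨a−a′,v′⟩`.  [OURS] -/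
def cwxy (x y : ℤ) : ℤ := if 0 < x ∧ y < 0 then x - y else 0

/-- The crossing weight of a pair of values is non-negative.  [OURS · plumbing] -/
theorem cwxy_nonneg (x y : ℤ) : 0 ≤ cwxy x y := by unfold cwxy; split_ifs <;> omega

/-- Sub-additive splitting under `(x, y) ↦ (x, x+y), (x+y, y)`.  [OURS · PROVED] -/
theorem cwxy_split_le (x y : ℤ) : cwxy x (x + y) + cwxy (x + y) y ≤ cwxy x y := by
  unfold cwxy; split_ifs <;> omega

/-- STRICT splitting when positive.  [OURS · PROVED] -/
theorem cwxy_split_lt (x y : ℤ) (h : 0 < cwxy x y) : cwxy x (x + y) + cwxy (x + y) y < cwxy x y := by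
  revert h; unfold cwxy; split_ifs <;> omega

/-- A separated pair has positive crossing weight.  [OURS · plumbing] -/
theorem cwxy_pos {x y : ℤ} (hx : 0 < x) (hy : y < 0) : 0 < cwxy x y := by
  unfold cwxy; rw [if_pos ⟨hx, hy⟩]; omega

/-- Crossing weight of the ordered pair `(a, a′)` on the cone `(v, v′)`.  [OURS] -/
def cw (a a' v v' : ℤ × ℤ) : ℤ := cwxy (ip a v - ip a' v) (ip a v' - ip a' v')

/-- The crossing weight of two exponents on a cone is non-negative.  [OURS · plumbing] -/
theorem cw_nonneg (a a' v v' : ℤ × ℤ) : 0 ≤ cw a a' v v' := cwxy_nonneg _ _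

/-- Crossing weight on the first child of a subdivision.  [OURS · plumbing] -/
theorem cw_child₁ (a a' v v' : ℤ × ℤ) :
    cw a a' v (v + v') = cwxy (ip a v - ip a' v) ((ip a v - ip a' v) + (ip a v' - ip a' v')) := by
  unfold cw; rw [ip_add, ip_add]; congr 1; ring

/-- Crossing weight on the second child of a subdivision.  [OURS · plumbing] -/
theorem cw_child₂ (a a' v v' : ℤ × ℤ) :
    cw a a' (v + v') v' = cwxy ((ip a v - ip a' v) + (ip a v' - ip a' v')) (ip a v' - ip a' v') := by
  unfold cw; rw [ip_add, ip_add]; congr 1; ring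

/-- Sub-additivity of the crossing weight under subdivision.  [OURS · proved] -/
theorem cw_split_le (a a' v v' : ℤ × ℤ) : cw a a' v (v + v') + cw a a' (v + v') v' ≤ cw a a' v v' := by
  rw [cw_child₁, cw_child₂]; exact cwxy_split_le _ _

/-- STRICT sub-additivity of a positive crossing weight under subdivision.  [OURS · proved] -/
theorem cw_split_lt (a a' v v' : ℤ × ℤ) (h : 0 < cw a a' v v') : cw a a' v (v + v') + cw a a' (v + v') v' < cw a a' v v' := by
  rw [cw_child₁, cw_child₂]; exact cwxy_split_lt _ _ h

/-- The CROSSING WEIGHT of the cone `(v, v′)` with respect to the cloud `B`.  [OURS] -/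
def D (B : Finset (ℤ × ℤ)) (v v' : ℤ × ℤ) : ℤ := ∑ a ∈ B, ∑ a' ∈ B, cw a a' v v'

/-- The crossing weight of a cone is non-negative.  [OURS · plumbing] -/
theorem D_nonneg (B : Finset (ℤ × ℤ)) (v v' : ℤ × ℤ) : 0 ≤ D B v v' :=
  Finset.sum_nonneg fun a _ => Finset.sum_nonneg fun a' _ => cw_nonneg a a' v v'

/-- **Sub-additive splitting of the crossing weight under subdivision.**  [OURS · PROVED] -/
theorem D_split_le (B : Finset (ℤ × ℤ)) (v v' : ℤ × ℤ) : D B v (v + v') + D B (v + v') v' ≤ D B v v' := by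
  unfold D; rw [← Finset.sum_add_distrib]
  refine Finset.sum_le_sum fun a _ => ?_
  rw [← Finset.sum_add_distrib]
  exact Finset.sum_le_sum fun a' _ => cw_split_le a a' v v'

/-- **STRICT splitting when the cone is crossed.**  [OURS · PROVED] -/
theorem D_split_lt (B : Finset (ℤ × ℤ)) (v v' : ℤ × ℤ) (h : 0 < D B v v') :
    D B v (v + v') + D B (v + v') v' < D B v v' := by
  have h0 : ∑ a ∈ B, ∑ a' ∈ B, (fun _ => (0 : ℤ)) a' < ∑ a ∈ B, ∑ a' ∈ B, cw a a' v v' := by simpa [D] using h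
  obtain ⟨a, ha, hlt⟩ := Finset.exists_lt_of_sum_lt h0
  obtain ⟨a', ha', hlt'⟩ := Finset.exists_lt_of_sum_lt hlt
  unfold D; rw [← Finset.sum_add_distrib]
  refine Finset.sum_lt_sum (fun c _ => ?_) ⟨a, ha, ?_⟩
  · rw [← Finset.sum_add_distrib]; exact Finset.sum_le_sum fun c' _ => cw_split_le c c' v v'
  · rw [← Finset.sum_add_distrib]
    exact Finset.sum_lt_sum (fun c' _ => cw_split_le a c' v v') ⟨a', ha', cw_split_lt a a' v v' hlt'⟩

/-- **`D = 0` forces a common minimiser.**  [OURS · PROVED] -/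
theorem exists_common_min {B : Finset (ℤ × ℤ)} (hB : B.Nonempty) (v v' : ℤ × ℤ) (hD : D B v v' = 0) :
    ∃ a ∈ B, (∀ c ∈ B, ip a v ≤ ip c v) ∧ (∀ c ∈ B, ip a v' ≤ ip c v') := by
  classical
  obtain ⟨a₀, ha₀, hmin₀⟩ := B.exists_min_image (fun a => ip a v) hB
  have hA : (B.filter fun a => ip a v = ip a₀ v).Nonempty := ⟨a₀, by simp [ha₀]⟩
  obtain ⟨a₁, ha₁, hmin₁⟩ := (B.filter fun a => ip a v = ip a₀ v).exists_min_image (fun a => ip a v') hA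
  simp only [Finset.mem_filter] at ha₁ hmin₁
  refine ⟨a₁, ha₁.1, fun c hc => by rw [ha₁.2]; exact hmin₀ c hc, fun c hc => ?_⟩
  by_contra hlt
  push Not at hlt
  by_cases hcv : ip c v = ip a₀ v
  · exact absurd (hmin₁ c ⟨hc, hcv⟩) (not_le.mpr hlt)
  · have hgt' : ip a₁ v < ip c v := by rw [ha₁.2]; exact lt_of_le_of_ne (hmin₀ c hc) (Ne.symm hcv)
    have hpos : 0 < cw c a₁ v v' := by unfold cw; exact cwxy_pos (by omega) (by omega)
    have hzero : cw c a₁ v v' = 0 := by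
      have hD' := hD
      unfold D at hD'
      have h1 := (Finset.sum_eq_zero_iff_of_nonneg (fun a _ => Finset.sum_nonneg fun a' _ => cw_nonneg a a' v v')).1 hD' c hc
      exact (Finset.sum_eq_zero_iff_of_nonneg (fun a' _ => cw_nonneg c a' v v')).1 h1 a₁ ha₁.1
    omega

/-- Additivity of the support function on an uncrossed cone.  [OURS · PROVED] -/
theorem hgt_add_eq {B : Finset (ℤ × ℤ)} (hB : B.Nonempty) (v v' : ℤ × ℤ) (hD : D B v v' = 0) :
    hgt B (v + v') = hgt B v + hgt B v' := by
  obtain ⟨a, ha, h1, h2⟩ := exists_common_min hB v v' hD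
  refine le_antisymm ?_ (hgt_add_ge hB v v')
  rw [hgt_eq_of_min ha h1, hgt_eq_of_min ha h2, ← ip_add]; exact hgt_le ha _

end Summit.ResolutionOfSingularities.ResolutionOfSingularities.Cruxes.SigmaMaxModifications.IdeasL1Idea2R12.SharedGame2
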